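import Summits.CriticalPhenomena.Ising3DConformalLimit.Theses.LogPolarProxy
import Literature.Probability.LatticeModels.PointwiseScalingLimitSelfSimilar
import Literature.Probability.LatticeModels.CriticalScalingDimension
import HarnessLib

/-!
# Item stmt-CriticalPhenomena-4586 `LogPolarProxy.RhoRegularVariation` — proved (the Karamata step, locally uniformly)

Route `LogPolarProxy` (sub-problem `CriticalPhenomena/Ising3DConformalLimit`), support item: if `ρ > 0` on `(0,1]`,
`HasPointwiseScalingLimit (criticalCorr 3) ρ S`, `IsNondegenerateTwoPoint S` and `IsScaleCovariant Δ S`, then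
`ρ(cδ)/ρ(δ) → c^{-Δ}` as `δ → 0⁺`, LOCALLY UNIFORMLY in `c ∈ (0, ∞)`.

Proof. At the axis pair `x₀ = (0, e₀)`: `⌊c x/(cδ)⌋ = ⌊x/δ⌋` (`latticeApprox_smul`), so
`ρ(cδ)² ⟨σ_{[0]}σ_{[e₀/δ]}⟩` is the rescaled pair correlator at mesh `cδ` and point `c • x₀`, while `ρ(δ)²⟨…⟩` is the one
at mesh `δ` and point `x₀`. The scaling limit converges LOCALLY UNIFORMLY on the non-coincident configurations, hence
uniformly on the compact segment `{c • x₀ : c ∈ [a,b]}` (`0 < a`), and for `δ < η₀/b` every mesh `cδ`, `c ≤ b`, is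
below the uniformity threshold `η₀`: so `ρ(cδ)²⟨…⟩ → S₂(c x₀) = c^{-2Δ} S₂(x₀)` uniformly in `c ∈ [a,b]`, the
denominator tends to `S₂(x₀) > 0`, the ratio of squares tends to `c^{-2Δ}` uniformly, and square roots are taken with
the uniform lower bound `c^{-Δ} ≥ min(a^{-Δ}, b^{-Δ}) > 0`. The pointwise statement is the tree's
(`HasPointwiseScalingLimit.exists_rpow_scale_and_ratio`, `MoebiusLimitExistsNegative.tendsto_rho_ratio`); the local
uniformity is what this item adds. Recorded by the lead of line `Sketch` of the crux `ExistsContinuousLimit`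
(stmt-4582; the card's dividend "ρ_pin regularly varying"). [folklore]
-/

noncomputable section

namespace Summit.CriticalPhenomena.Ising3DConformalLimit.LogPolarProxyRhoRegularVariation

open Literature.Probability.LatticeModels Filter Set Topology

/-- A power `c ^ e` on a segment `[a, b] ⊂ (0, ∞)` is squeezed between the endpoint values. [folklore] -/
theorem rpow_mem_bounds {a b c e : ℝ} (ha : 0 < a) (hac : a ≤ c) (hcb : c ≤ b) :
    min (a ^ e) (b ^ e) ≤ c ^ e ∧ c ^ e ≤ max (a ^ e) (b ^ e) := by
  have hc : 0 < c := lt_of_lt_of_le ha hac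
  rcases le_or_gt 0 e with he | he
  · exact ⟨le_trans (min_le_left _ _) (Real.rpow_le_rpow ha.le hac he),
      le_trans (Real.rpow_le_rpow hc.le hcb he) (le_max_right _ _)⟩
  · exact ⟨le_trans (min_le_right _ _) (Real.rpow_le_rpow_of_nonpos hc hcb he.le),
      le_trans (Real.rpow_le_rpow_of_nonpos ha hac he.le) (le_max_left _ _)⟩

/-- The elementary square-root step: for `r ≥ 0 < t`, `|r − t| ≤ |r² − t²| / t`. [folklore] -/
theorem abs_sub_le_abs_sq_sub_sq_div {r t : ℝ} (hr : 0 ≤ r) (ht : 0 < t) :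
    |r - t| ≤ |r ^ 2 - t ^ 2| / t := by
  rw [le_div_iff₀ ht, show r ^ 2 - t ^ 2 = (r - t) * (r + t) by ring, abs_mul]
  refine mul_le_mul_of_nonneg_left ?_ (abs_nonneg _)
  rw [abs_of_pos (by linarith)]
  linarith

/-- The elementary ratio step: `|B/A − L| ≤ (|B − L s| + L |s − A|) / A` for `A > 0`, `L ≥ 0`. [folklore] -/
theorem abs_div_sub_le {A B L s : ℝ} (hA : 0 < A) (hL : 0 ≤ L) :
    |B / A - L| ≤ (|B - L * s| + L * |s - A|) / A := by
  rw [div_sub' (ne_of_gt hA), abs_div, abs_of_pos hA, div_le_div_iff_of_pos_right hA]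
  calc |B - A * L| = |(B - L * s) + L * (s - A)| := by ring_nf
    _ ≤ |B - L * s| + |L * (s - A)| := abs_add_le _ _
    _ = |B - L * s| + L * |s - A| := by rw [abs_mul, abs_of_nonneg hL]

/-- **Item stmt-CriticalPhenomena-4586 `RhoRegularVariation`: the renormalisation of a non-degenerate scale-covariant
pointwise scaling limit of the critical `ℤ³` correlators is regularly varying of index `-Δ`, locally uniformly:**
`ρ(cδ)/ρ(δ) → c^{-Δ}` as `δ → 0⁺`, locally uniformly in `c ∈ (0,∞)`. [folklore] -/
theorem rhoRegularVariation_proof :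
    Summit.CriticalPhenomena.Ising3DConformalLimit.Theses.LogPolarProxy.RhoRegularVariation := by
  intro ρ Δ S hρ hlim hnd hsc
  rw [tendstoLocallyUniformlyOn_iff_forall_isCompact isOpen_Ioi]
  intro K hKsub hK
  rw [Metric.tendstoUniformlyOn_iff]
  intro ε hε
  -- empty `K` is trivial; otherwise `K ⊆ [a, b]` with `0 < a`
  rcases K.eq_empty_or_nonempty with rfl | hKne
  · exact Eventually.of_forall fun δ c hc => absurd hc (Set.notMem_empty c)
  obtain ⟨a, haK, ha⟩ := hK.exists_isLeast hKne
  obtain ⟨b, hbK, hb⟩ := hK.exists_isGreatest hKne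
  have ha0 : 0 < a := hKsub haK
  have hab : a ≤ b := ha hbK
  have hb0 : 0 < b := lt_of_lt_of_le ha0 hab
  -- the reference pair and its limit value
  set x₀ : Fin 2 → EuclideanSpace ℝ (Fin 3) := ![0, EuclideanSpace.single (0 : Fin 3) (1:ℝ)] with hx₀def
  have hx₀ : x₀ ∈ NonCoincident 3 2 := zero_unitVec_mem_nonCoincident one_ne_zero
  set s₀ : ℝ := S 2 x₀ with hs₀def
  have hs₀ : 0 < s₀ := hnd _ hx₀
  -- uniform bounds for the powers on `[a, b]`
  set L : ℝ := max (a ^ (-(2:ℝ) * Δ)) (b ^ (-(2:ℝ) * Δ)) with hLdef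
  set m : ℝ := min (a ^ (-Δ)) (b ^ (-Δ)) with hmdef
  have hL0 : 0 ≤ L := le_trans (Real.rpow_nonneg ha0.le _) (le_max_left _ _)
  have hm0 : 0 < m := lt_min (Real.rpow_pos_of_pos ha0 _) (Real.rpow_pos_of_pos hb0 _)
  -- the tolerance
  set ε' : ℝ := min (s₀ / 2) (ε * m * s₀ / (4 * (1 + L))) with hε'def
  have hε'0 : 0 < ε' := lt_min (by positivity) (by positivity)
  have hε's : ε' ≤ s₀ / 2 := min_le_left _ _
  have hε'e : ε' ≤ ε * m * s₀ / (4 * (1 + L)) := min_le_right _ _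
  -- (1) the denominator: `A δ = ρ δ² G_δ → s₀`
  have hA : Tendsto (fun δ => rescaledCorrelator (criticalCorr 3) ρ 2 δ x₀) (𝓝[>] 0) (𝓝 s₀) :=
    (hlim 2).tendsto_at hx₀
  have hA_ev : ∀ᶠ δ in 𝓝[>] (0:ℝ), dist (rescaledCorrelator (criticalCorr 3) ρ 2 δ x₀) s₀ < ε' :=
    Metric.tendsto_nhds.1 hA ε' hε'0
  -- (2) the numerators: uniform convergence on the compact segment `{c • x₀ : c ∈ [a,b]}`
  set φ : ℝ → (Fin 2 → EuclideanSpace ℝ (Fin 3)) := fun c => fun i => c • x₀ i with hφdef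
  have hφcont : Continuous φ := by
    refine continuous_pi fun i => ?_
    exact continuous_id.smul continuous_const
  set K' : Set (Fin 2 → EuclideanSpace ℝ (Fin 3)) := φ '' Set.Icc a b with hK'def
  have hK'cpt : IsCompact K' := isCompact_Icc.image hφcont
  have hK'sub : K' ⊆ NonCoincident 3 2 := by
    rintro _ ⟨c, hc, rfl⟩
    exact smul_mem_nonCoincident (lt_of_lt_of_le ha0 hc.1).ne' hx₀
  have hU : TendstoUniformlyOn (rescaledCorrelator (criticalCorr 3) ρ 2) (S 2) (𝓝[>] 0) K' :=
    (tendstoLocallyUniformlyOn_iff_forall_isCompact (isOpen_nonCoincident 3 2)).1 (hlim 2) K' hK'sub hK'cpt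
  have hU' := Metric.tendstoUniformlyOn_iff.1 hU ε' hε'0
  obtain ⟨η₀, hη₀, hη⟩ := (nhdsGT_basis (0:ℝ)).eventually_iff.1 hU'
  -- (3) the eventual range of `δ`
  have hδ_ev : ∀ᶠ δ in 𝓝[>] (0:ℝ), δ ∈ Set.Ioo (0:ℝ) (min 1 (min (1 / b) (η₀ / b))) :=
    (nhdsGT_basis (0:ℝ)).mem_of_mem (lt_min one_pos (lt_min (by positivity) (by positivity)))
  filter_upwards [hA_ev, hδ_ev] with δ hAδ hδ c hcK
  -- unpack the range of `δ` and of `c`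
  have hδ0 : 0 < δ := hδ.1
  have hδ1 : δ < 1 := lt_of_lt_of_le hδ.2 (min_le_left _ _)
  have hδb : δ < 1 / b := lt_of_lt_of_le hδ.2 (le_trans (min_le_right _ _) (min_le_left _ _))
  have hδη : δ < η₀ / b := lt_of_lt_of_le hδ.2 (le_trans (min_le_right _ _) (min_le_right _ _))
  have hac : a ≤ c := ha hcK
  have hcb : c ≤ b := hb hcK
  have hc0 : 0 < c := lt_of_lt_of_le ha0 hac
  have hcδ0 : 0 < c * δ := mul_pos hc0 hδ0
  have hcδ1 : c * δ ≤ 1 := by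
    have : c * δ ≤ b * δ := mul_le_mul_of_nonneg_right hcb hδ0.le
    have hb' : b * δ < 1 := by rwa [lt_div_iff₀ hb0, mul_comm] at hδb
    linarith
  have hcδη : c * δ < η₀ := by
    have : c * δ ≤ b * δ := mul_le_mul_of_nonneg_right hcb hδ0.le
    have hb' : b * δ < η₀ := by rwa [lt_div_iff₀ hb0, mul_comm] at hδη
    linarith
  have hρδ : 0 < ρ δ := hρ δ ⟨hδ0, hδ1.le⟩
  have hρcδ : 0 < ρ (c * δ) := hρ (c * δ) ⟨hcδ0, hcδ1⟩
  -- the power bounds at `c`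
  have hcpow2 : c ^ (-(2:ℝ) * Δ) ≤ L := (rpow_mem_bounds (e := -(2:ℝ) * Δ) ha0 hac hcb).2
  have hcpow1 : m ≤ c ^ (-Δ) := (rpow_mem_bounds (e := -Δ) ha0 hac hcb).1
  have hcΔ : 0 < c ^ (-Δ) := Real.rpow_pos_of_pos hc0 _
  have hc2Δ : 0 ≤ c ^ (-(2:ℝ) * Δ) := Real.rpow_nonneg hc0.le _
  have hsq : c ^ (-(2:ℝ) * Δ) = (c ^ (-Δ)) ^ 2 := by
    rw [show (-(2:ℝ) * Δ) = (-Δ) * 2 by ring, Real.rpow_mul hc0.le, Real.rpow_two]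
  -- names: `A = ρ δ² G`, `B = ρ(cδ)² G`, `G` the lattice pair correlator at mesh `δ`
  set G : ℝ := criticalCorr 3 2 (fun i => latticeApprox δ (x₀ i)) with hGdef
  have hAeq : rescaledCorrelator (criticalCorr 3) ρ 2 δ x₀ = ρ δ ^ 2 * G := rfl
  have hBeq : rescaledCorrelator (criticalCorr 3) ρ 2 (c * δ) (φ c) = ρ (c * δ) ^ 2 * G := by
    rw [rescaledCorrelator_apply]
    congr 2
    funext i
    exact latticeApprox_smul hc0.ne' δ (x₀ i)
  -- (1') the denominator is within `ε'` of `s₀`, hence at least `s₀/2`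
  rw [Real.dist_eq, hAeq] at hAδ
  have hApos : s₀ / 2 ≤ ρ δ ^ 2 * G := by
    have := abs_sub_lt_iff.1 hAδ
    linarith [this.2]
  have hA0 : 0 < ρ δ ^ 2 * G := lt_of_lt_of_le (by positivity) hApos
  have hG0 : 0 < G := pos_of_mul_pos_right hA0 (sq_nonneg _)  -- `G > 0`
  -- (2') the numerator is within `ε'` of `S₂(c • x₀) = c^{-2Δ} s₀`
  have hBδ : |ρ (c * δ) ^ 2 * G - c ^ (-(2:ℝ) * Δ) * s₀| < ε' := by
    have hmem : c * δ ∈ Set.Ioo (0:ℝ) η₀ := ⟨hcδ0, hcδη⟩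
    have hmem' : φ c ∈ K' := ⟨c, ⟨hac, hcb⟩, rfl⟩
    have h := hη hmem (φ c) hmem'
    rw [Real.dist_eq, hBeq] at h
    have hS : S 2 (φ c) = c ^ (-(2:ℝ) * Δ) * s₀ := by
      have := hsc 2 c hc0 x₀
      simpa [hφdef] using this
    rw [hS, abs_sub_comm] at h
    exact h
  -- (4) the ratio of squares is within `ε m` of `c^{-2Δ}`
  have hratio_eq : (ρ (c * δ) / ρ δ) ^ 2 = (ρ (c * δ) ^ 2 * G) / (ρ δ ^ 2 * G) := by
    rw [div_pow, mul_div_mul_right _ _ hG0.ne']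
  have hratio : |(ρ (c * δ) / ρ δ) ^ 2 - c ^ (-(2:ℝ) * Δ)| < ε * m := by
    rw [hratio_eq]
    refine lt_of_le_of_lt (abs_div_sub_le hA0 hc2Δ (s := s₀)) ?_
    rw [div_lt_iff₀ hA0]
    have h1 : |ρ (c * δ) ^ 2 * G - c ^ (-(2:ℝ) * Δ) * s₀| + c ^ (-(2:ℝ) * Δ) * |s₀ - ρ δ ^ 2 * G|
        < ε' + L * ε' := by
      have h2 : c ^ (-(2:ℝ) * Δ) * |s₀ - ρ δ ^ 2 * G| ≤ L * ε' := by
        refine mul_le_mul hcpow2 ?_ (abs_nonneg _) hL0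
        rw [abs_sub_comm]; exact hAδ.le
      linarith
    refine lt_of_lt_of_le h1 ?_
    -- `ε'(1 + L) ≤ ε m (s₀/2) ≤ ε m A`
    have h3 : ε' + L * ε' ≤ ε * m * (s₀ / 2) := by
      have hL1 : (1 + L) ≠ 0 := by positivity
      have key : ε' * (1 + L) ≤ ε * m * s₀ / 4 :=
        calc ε' * (1 + L) ≤ ε * m * s₀ / (4 * (1 + L)) * (1 + L) :=
              mul_le_mul_of_nonneg_right hε'e (by positivity)
          _ = ε * m * s₀ / 4 := by field_simp
      have hpos : 0 ≤ ε * m * s₀ := by positivity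
      nlinarith
    have h4 : ε * m * (s₀ / 2) ≤ ε * m * (ρ δ ^ 2 * G) :=
      mul_le_mul_of_nonneg_left hApos (by positivity)
    linarith
  -- (5) square roots
  rw [Real.dist_eq, abs_sub_comm]
  have hr0 : 0 ≤ ρ (c * δ) / ρ δ := (div_pos hρcδ hρδ).le
  calc |ρ (c * δ) / ρ δ - c ^ (-Δ)|
      ≤ |(ρ (c * δ) / ρ δ) ^ 2 - (c ^ (-Δ)) ^ 2| / c ^ (-Δ) := abs_sub_le_abs_sq_sub_sq_div hr0 hcΔ
    _ < ε * m / c ^ (-Δ) := by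
        rw [← hsq]
        exact div_lt_div_of_pos_right hratio hcΔ
    _ ≤ ε := by
        rw [div_le_iff₀ hcΔ]
        exact mul_le_mul_of_nonneg_left hcpow1 hε.le

end Summit.CriticalPhenomena.Ising3DConformalLimit.LogPolarProxyRhoRegularVariation

end
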